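import Summits.Schanuel.Schanuel.Theorems.DiophantineDichotomyApproximationPropertyDegOneLift

/-!
# Schanuel / DiophantineDichotomy — item `ApproximationPropertyDegOne` (stmt-Schanuel-11037), closed

Route `Schanuel/DiophantineDichotomy`, support item stmt-Schanuel-11037: the case `t = 1` of
Philippon's approximation property in the `(d, log H)` currency,
`Summit.Schanuel.Schanuel.Theses.DiophantineDichotomy.ApproximationPropertyDegOne`:
for every finite `ι` and `θ : ι → ℂ` with `trdeg_ℚ ℚ(θ) ≤ 1` there is `c ≥ 1` such that for all real
`c ≤ Δ ≤ Y` some `γ : ι → ℂ`, `d H : ℕ` satisfy `[ℚ(γ):ℚ] ≤ d`, every `γᵢ` is a root of a non-zero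
integer polynomial of degree `≤ d` and naive height `≤ H`, `d ≤ cΔ`, `log H ≤ cY` and
`‖γ − θ‖ ≤ exp(−(log H · Δ + d · Y)/c)` (ALL scales, OUTPUT-dependent exponent).

Proof (unconditional).
* `trdeg = 0` (all coordinates algebraic, in particular `ι = ∅`): `γ = θ` with fixed certificates
  (`of_forall_isAlgebraic`; the argument of the crux disprover's §4, `Cruxes/ApproximationProperty/Disproof.lean`).
* `trdeg = 1`: `K = ℚ(θ)` is a function field of one variable; pick `θ₀ ∈ K` transcendental.  At the
  scale `(Δ, Y)` apply DIAZ'S THEOREM (Bugeaud 2004 Thm. 8.11, discharged in tree: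
  `Literature.NumberTheory.DiophantineApproximation.Bugeaud2004_thm_8_11_holds`) to `ξ = θ₀` with
  `n = ⌊Δ⌋`, `M = e^Y`: an algebraic `α` with irreducible `P ∈ ℤ[X]`, `deg P ≤ n`, `M(P) ≤ e^Y`,
  `|ξ − α| ≤ exp(−0.006 (n log M(P) + deg P · Y))`; then LIFT `α` to all coordinates with the naive-currency
  lifting lemma `ApproximationPropertyDegOne.lift` (Roy–Waldschmidt 1997, proof of Thm. 3.1 (i), via
  the tree's formalisation): `γ` with joint degree `≤ D ≤ A·deg P`, certificates of height
  `log H ≤ A(deg P + log M(P))`, `‖γ − θ‖ ≤ A|α − ξ|^{1/m}`.  Since the accuracy is OUTPUT-dependent on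
  BOTH sides, `(log H · Δ + D · Y)/c ≤ 2A(deg P · Y + n log M(P))/c` is beaten by
  `0.006 (n log M(P) + deg P · Y)/m` once `c ≥ 1000 m A` (`of_trdeg_eq_one`).
Sources: G. Diaz, C. R. Acad. Sci. Paris 324 (1997) 969–972; Y. Bugeaud, *Approximation by algebraic
numbers* (CUP 2004) Thm. 8.11; M. Laurent, D. Roy, Ann. Inst. Fourier 49 (1999) 27–55, intro. and
§§5–6; D. Roy, M. Waldschmidt, Ann. Sci. ÉNS 30 (1997) 753–796, proof of Théorème 3.1.
-/

set_option linter.dupNamespace false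

noncomputable section

namespace Summit.Schanuel.Schanuel.Theorems

open Polynomial IntermediateField
open Literature.NumberTheory.Transcendental.RoyWaldschmidt1997
open Literature.NumberTheory.DiophantineGeometry
open Literature.NumberTheory.DiophantineApproximation (Bugeaud2004_thm_8_11_holds one_le_mahlerMeasure_map)

namespace ApproximationPropertyDegOne

/-- **Algebraic points.**  If every coordinate of `θ` is algebraic over `ℚ` (the case `trdeg ℚ(θ) = 0`,
including `ι = ∅`), the conclusion of `ApproximationPropertyDegOne` holds with `γ = θ` and fixed
certificates. [folklore; cf. the crux disprover's `apAt_of_forall_isAlgebraic`] -/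
theorem of_forall_isAlgebraic {ι : Type} [Fintype ι] (θ : ι → ℂ) (hθ : ∀ i, IsAlgebraic ℚ (θ i)) :
    ∃ c : ℝ, 1 ≤ c ∧ ∀ Δ Y : ℝ, c ≤ Δ → Δ ≤ Y → ∃ (γ : ι → ℂ) (d H : ℕ),
      Module.finrank ℚ ↥(IntermediateField.adjoin ℚ (Set.range γ)) ≤ d ∧
      (∀ i, ∃ P : Polynomial ℤ, P ≠ 0 ∧ P.natDegree ≤ d ∧ (∀ k, |P.coeff k| ≤ (H : ℤ)) ∧
        Polynomial.aeval (γ i) P = 0) ∧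
      (d : ℝ) ≤ c * Δ ∧ Real.log H ≤ c * Y ∧
      ‖γ - θ‖ ≤ Real.exp (-((Real.log H * Δ + d * Y) / c)) := by
  classical
  -- adapted from `Cruxes/ApproximationProperty/Disproof.lean` §4 (refuter-cdisprove-stmt-Schanuel-6117)
  have hZ : ∀ i, ∃ P : ℤ[X], P ≠ 0 ∧ aeval (θ i) P = 0 := fun i =>
    (IsFractionRing.isAlgebraic_iff ℤ ℚ ℂ).mpr (hθ i)
  choose P hP0 hPθ using hZ
  set d : ℕ := Module.finrank ℚ ↥(IntermediateField.adjoin ℚ (Set.range θ)) +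
    ∑ i, (P i).natDegree with hd
  set H : ℕ := ∑ i, ∑ k ∈ (P i).support, ((P i).coeff k).natAbs with hH
  have hcoeff : ∀ i k, |(P i).coeff k| ≤ (H : ℤ) := by
    intro i k
    by_cases hk : k ∈ (P i).support
    · have h1 : ((P i).coeff k).natAbs ≤ ∑ k ∈ (P i).support, ((P i).coeff k).natAbs :=
        Finset.single_le_sum (f := fun k => ((P i).coeff k).natAbs) (fun _ _ => Nat.zero_le _) hk
      have h2 : ∑ k ∈ (P i).support, ((P i).coeff k).natAbs ≤ H :=
        Finset.single_le_sum (f := fun i => ∑ k ∈ (P i).support, ((P i).coeff k).natAbs)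
          (fun _ _ => Nat.zero_le _) (Finset.mem_univ i)
      rw [Int.abs_eq_natAbs]
      exact_mod_cast h1.trans h2
    · rw [notMem_support_iff.mp hk, abs_zero]
      positivity
  have hdeg : ∀ i, (P i).natDegree ≤ d := fun i => by
    rw [hd]
    exact le_add_left (Finset.single_le_sum (f := fun i => (P i).natDegree)
      (fun _ _ => Nat.zero_le _) (Finset.mem_univ i))
  set c : ℝ := 1 + d + Real.log H with hc
  have hlogH : 0 ≤ Real.log H := Real.log_natCast_nonneg H
  have hd0 : (0 : ℝ) ≤ d := by positivity
  have hc1 : 1 ≤ c := by rw [hc]; linarith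
  refine ⟨c, hc1, fun Δ Y hΔ hY => ⟨θ, d, H, le_self_add, fun i => ⟨P i, hP0 i, hdeg i, hcoeff i,
    hPθ i⟩, ?_, ?_, ?_⟩⟩
  · calc (d : ℝ) ≤ c := by rw [hc]; linarith
      _ ≤ c * Δ := le_mul_of_one_le_right (by linarith) (hc1.trans hΔ)
  · have hΔ1 : 1 ≤ Δ := hc1.trans hΔ
    calc Real.log H ≤ c := by rw [hc]; linarith
      _ ≤ c * Y := le_mul_of_one_le_right (by linarith) (hΔ1.trans hY)
  · simp [(Real.exp_pos _).le]

set_option maxHeartbeats 1600000 in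
/-- **Points of a curve** (`trdeg ℚ(θ) = 1`): Diaz's theorem at a transcendental `θ₀ ∈ ℚ(θ)` at the
scale `(⌊Δ⌋, e^Y)`, lifted to all coordinates by `lift`; the two output-dependent exponents are
compared through `(log H·Δ + D·Y) ≤ 2A(deg P·Y + ⌊Δ⌋ log M(P))`.
[cite: Bugeaud2004, Thm 8.11; RoyWaldschmidt1997ENS, proof of Théorème 3.1; LaurentRoy1999 pp. 27–28] -/
theorem of_trdeg_eq_one {ι : Type} [Fintype ι] (θ : ι → ℂ)
    (htr : Algebra.trdeg ℚ ↥(IntermediateField.adjoin ℚ (Set.range θ)) = 1) :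
    ∃ c : ℝ, 1 ≤ c ∧ ∀ Δ Y : ℝ, c ≤ Δ → Δ ≤ Y → ∃ (γ : ι → ℂ) (d H : ℕ),
      Module.finrank ℚ ↥(IntermediateField.adjoin ℚ (Set.range γ)) ≤ d ∧
      (∀ i, ∃ P : Polynomial ℤ, P ≠ 0 ∧ P.natDegree ≤ d ∧ (∀ k, |P.coeff k| ≤ (H : ℤ)) ∧
        Polynomial.aeval (γ i) P = 0) ∧
      (d : ℝ) ≤ c * Δ ∧ Real.log H ≤ c * Y ∧
      ‖γ - θ‖ ≤ Real.exp (-((Real.log H * Δ + d * Y) / c)) := by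
  classical
  set K : IntermediateField ℚ ℂ := IntermediateField.adjoin ℚ (Set.range θ) with hK
  haveI : IsAlgFunctionField ℚ K :=
    isAlgFunctionField_of_fg (IntermediateField.fg_adjoin_of_finite (Set.finite_range θ)) htr
  obtain ⟨θ₀, hθ₀⟩ := IsAlgFunctionField.exists_transcendental (K := ℚ) (F := K)
  have hmem : ∀ i, θ i ∈ K := fun i => IntermediateField.subset_adjoin ℚ _ (Set.mem_range_self i)
  set a : ι → K := fun i => ⟨θ i, hmem i⟩ with ha
  obtain ⟨ε₀, hε₀, A, hA1, m, hm, hlift⟩ := ApproximationPropertyDegOne.lift θ₀ hθ₀ a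
  set ξ : ℂ := (θ₀ : ℂ) with hξ
  /- ## the constant -/
  have hmR : (1 : ℝ) ≤ m := by exact_mod_cast hm
  have hA0 : 0 < A := by linarith
  set L₀ : ℝ := max 0 (-Real.log ε₀) with hL₀
  have hL₀0 : 0 ≤ L₀ := le_max_left _ _
  have hlog4 : 0 ≤ Real.log (4 + ‖ξ‖) := Real.log_nonneg (by linarith [norm_nonneg ξ])
  set c : ℝ := 51 + 100 * Real.log (4 + ‖ξ‖) + 200 * L₀ + 1000 * m * A with hc
  have hmA0 : 0 ≤ (m : ℝ) * A := by positivity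
  have hc51 : 51 ≤ c := by rw [hc]; nlinarith
  have hcA : 1000 * m * A ≤ c := by rw [hc]; nlinarith
  have hc0 : 0 < c := by linarith
  refine ⟨c, by linarith, fun Δ Y hΔ hY => ?_⟩
  have hΔ0 : 0 ≤ Δ := by linarith
  have hY0 : 0 ≤ Y := by linarith
  have hcY : c ≤ Y := hΔ.trans hY
  /- ## Diaz's theorem at `ξ = θ₀`, scale `n = ⌊Δ⌋`, `M = e^Y` -/
  set n : ℕ := ⌊Δ⌋₊ with hn
  have hn50 : 50 ≤ n := Nat.le_floor (by push_cast; linarith)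
  have hnΔ : (n : ℝ) ≤ Δ := Nat.floor_le hΔ0
  have hΔn : Δ ≤ n + 1 := (Nat.lt_floor_add_one Δ).le
  have hnR : (1 : ℝ) ≤ n := by exact_mod_cast (show 1 ≤ n by omega)
  have hnM : (n : ℝ) + 1 ≤ Real.exp Y := by
    have := Real.add_one_le_exp Y; linarith
  have hξM : (4 + ‖ξ‖) ^ 100 ≤ Real.exp Y := by
    have h1 : (4 + ‖ξ‖) ^ 100 = Real.exp (100 * Real.log (4 + ‖ξ‖)) := by
      rw [← Real.exp_log (pow_pos (by positivity : (0 : ℝ) < 4 + ‖ξ‖) 100), Real.log_pow]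
      norm_num
    rw [h1]
    exact Real.exp_le_exp.mpr (by linarith)
  obtain ⟨α, P, hPirr, hαP, hPn, hMP, hclose⟩ := Bugeaud2004_thm_8_11_holds ξ n (Real.exp Y) hn50 hnM hξM
  rw [Real.log_exp] at hclose
  have hP0 : P ≠ 0 := hPirr.ne_zero
  set d : ℕ := P.natDegree with hddef
  have hd : 0 < d := by
    refine Nat.pos_of_ne_zero fun h0 => ?_
    have hcP : P = C (P.coeff 0) := Polynomial.eq_C_of_natDegree_eq_zero h0
    have hc0' : P.coeff 0 = 0 := by
      rwa [hcP, aeval_C, algebraMap_int_eq, eq_intCast, Int.cast_eq_zero] at hαP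
    rw [hc0', C_0] at hcP
    exact hP0 hcP
  have hd1 : (1 : ℝ) ≤ d := by exact_mod_cast hd
  have hdn : (d : ℝ) ≤ n := by exact_mod_cast hPn
  set LMP : ℝ := Real.log (P.map (Int.castRingHom ℂ)).mahlerMeasure with hLMP
  have hMP1 : 1 ≤ (P.map (Int.castRingHom ℂ)).mahlerMeasure := one_le_mahlerMeasure_map P hP0
  have hLMP0 : 0 ≤ LMP := Real.log_nonneg hMP1
  have hLMPY : LMP ≤ Y := by
    have := Real.log_le_log (by linarith) hMP; rwa [Real.log_exp] at this
  set S : ℝ := n * LMP + d * Y with hS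
  have hSY : Y ≤ S := by
    have h1 : 0 ≤ (n : ℝ) * LMP := by positivity
    have h2 : Y ≤ d * Y := le_mul_of_one_le_left hY0 hd1
    rw [hS]; linarith
  have hS0 : 0 ≤ S := hY0.trans hSY
  -- `ε = |α - ξ| ≤ exp(-0.006 S) ≤ ε₀`
  set ε : ℝ := ‖α - ξ‖ with hε
  have hε0 : 0 ≤ ε := norm_nonneg _
  have hεS : ε ≤ Real.exp (-(6 / 1000 * S)) := by rw [hε, norm_sub_rev]; exact hclose
  have hεε₀ : ε ≤ ε₀ := by
    refine hεS.trans ?_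
    have h1 : -(6 / 1000 * S) ≤ -L₀ := by nlinarith
    have h2 : Real.exp (-L₀) ≤ ε₀ := by
      have h3 : -L₀ ≤ Real.log ε₀ := by
        have := le_max_right 0 (-Real.log ε₀); rw [← hL₀] at this; linarith
      calc Real.exp (-L₀) ≤ Real.exp (Real.log ε₀) := Real.exp_le_exp.mpr h3
        _ = ε₀ := Real.exp_log hε₀
    exact (Real.exp_le_exp.mpr h1).trans h2
  /- ## the lift -/
  obtain ⟨γ, D, H, hdD, hDA, hfin, hcert, hH1, hlogH, hdist⟩ := hlift P α hPirr hαP hεε₀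
  have hHR : (1 : ℝ) ≤ H := by exact_mod_cast hH1
  have hDd : (D : ℝ) ≤ A * d := hDA
  refine ⟨γ, D, H, hfin, hcert, ?_, ?_, ?_⟩
  · -- `D ≤ A d ≤ A Δ ≤ c Δ`
    calc (D : ℝ) ≤ A * d := hDd
      _ ≤ A * Δ := mul_le_mul_of_nonneg_left (hdn.trans hnΔ) hA0.le
      _ ≤ c * Δ := mul_le_mul_of_nonneg_right (by nlinarith) hΔ0
  · -- `log H ≤ A (d + log M(P)) ≤ 2 A Y ≤ c Y`
    have h1 : (d : ℝ) + LMP ≤ 2 * Y := by linarith [hdn.trans hnΔ]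
    have h2A : 2 * A ≤ c := by
      have : A ≤ m * A := le_mul_of_one_le_left hA0.le hmR
      linarith
    calc Real.log H ≤ A * (d + LMP) := hlogH
      _ ≤ A * (2 * Y) := mul_le_mul_of_nonneg_left h1 hA0.le
      _ = (2 * A) * Y := by ring
      _ ≤ c * Y := mul_le_mul_of_nonneg_right h2A hY0
  · -- the distance
    have hsup : ‖γ - θ‖ ≤ A * ε ^ (1 / (m : ℝ)) := by
      refine (pi_norm_le_iff_of_nonneg (by positivity)).mpr fun i => ?_
      simpa using hdist i
    refine hsup.trans ?_
    have hmpos : (0 : ℝ) < m := by linarith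
    -- `ε^{1/m} ≤ exp(-0.006 S / m)`
    have h1 : ε ^ (1 / (m : ℝ)) ≤ Real.exp (-(6 / 1000 * S) * (1 / (m : ℝ))) := by
      rw [Real.exp_mul]
      exact Real.rpow_le_rpow hε0 hεS (by positivity)
    have h2 : A * ε ^ (1 / (m : ℝ)) ≤ Real.exp (Real.log A + -(6 / 1000 * S) * (1 / (m : ℝ))) := by
      rw [Real.exp_add, Real.exp_log hA0]
      exact mul_le_mul_of_nonneg_left h1 hA0.le
    refine h2.trans (Real.exp_le_exp.mpr ?_)
    -- compare the exponents
    have e1 : Real.log H * Δ + D * Y ≤ 2 * A * S := by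
      have t1 : Real.log H * Δ ≤ A * (d + LMP) * Δ := mul_le_mul_of_nonneg_right hlogH hΔ0
      have t2 : A * (d : ℝ) * Δ ≤ A * d * Y := mul_le_mul_of_nonneg_left hY (by positivity)
      have t3 : A * LMP * Δ ≤ A * LMP * (2 * n) :=
        mul_le_mul_of_nonneg_left (by linarith) (by positivity)
      have t4 : (D : ℝ) * Y ≤ A * d * Y := mul_le_mul_of_nonneg_right hDd hY0
      have e : A * (d + LMP) * Δ = A * d * Δ + A * LMP * Δ := by ring
      have e' : 2 * A * S = 2 * (A * d * Y) + A * LMP * (2 * n) := by rw [hS]; ring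
      rw [e']
      linarith
    have e2 : (Real.log H * Δ + D * Y) / c ≤ (5 / 1000) * (S / m) := by
      have key : 2 * A * S ≤ (5 / 1000) * (S / m) * c := by
        have h1 : S * (400 * m * A) ≤ S * c := mul_le_mul_of_nonneg_left (by linarith) hS0
        have h2 : (5 / 1000) * (S / m) * c = S * c / (200 * m) := by ring
        rw [h2, le_div_iff₀ (by positivity)]
        have h3 : 2 * A * S * (200 * m) = S * (400 * m * A) := by ring
        rw [h3]
        linarith
      rw [div_le_iff₀ hc0]
      exact e1.trans key
    have e3 : Real.log A ≤ (1 / 1000) * (S / m) := by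
      have t1 : Real.log A ≤ A := (Real.log_le_sub_one_of_pos hA0).trans (by linarith)
      have t2 : A * (1000 * m) ≤ S := by
        calc A * (1000 * m) = 1000 * m * A := by ring
          _ ≤ c := hcA
          _ ≤ Y := hcY
          _ ≤ S := hSY
      have t3 : Real.log A * (1000 * m) ≤ A * (1000 * m) :=
        mul_le_mul_of_nonneg_right t1 (by positivity)
      rw [show (1 / 1000 : ℝ) * (S / m) = S / (1000 * m) by ring,
        le_div_iff₀ (by positivity)]
      linarith
    have e4 : -(6 / 1000 * S) * (1 / (m : ℝ)) = -(6 / 1000) * (S / m) := by ring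
    rw [e4]
    linarith

end ApproximationPropertyDegOne

/-- Closes item stmt-Schanuel-11037: the route decl `DiophantineDichotomy.ApproximationPropertyDegOne`
(Philippon's approximation property for `t = 1`, all scales, output-dependent exponent, naive
`(d, log H)` currency) — unconditionally, by Diaz's theorem (Bugeaud 2004 Thm. 8.11, discharged in
tree) at a transcendental element of `ℚ(θ)` and the Roy–Waldschmidt lifting to all coordinates; the
case `trdeg = 0` is trivial with `γ = θ`.
[cite: Bugeaud2004, Thm 8.11; LaurentRoy1999, intro. and §§5–6; RoyWaldschmidt1997ENS, Théorème 3.1] -/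
theorem approximationPropertyDegOne_proof :
    Summit.Schanuel.Schanuel.Theses.DiophantineDichotomy.ApproximationPropertyDegOne := by
  unfold Summit.Schanuel.Schanuel.Theses.DiophantineDichotomy.ApproximationPropertyDegOne
  intro ι _ θ htr
  rcases eq_or_ne (Algebra.trdeg ℚ ↥(IntermediateField.adjoin ℚ (Set.range θ))) 0 with h0 | h1
  · have halg : Algebra.IsAlgebraic ℚ ↥(IntermediateField.adjoin ℚ (Set.range θ)) :=
      trdeg_eq_zero_iff.mp h0
    refine ApproximationPropertyDegOne.of_forall_isAlgebraic θ fun i => ?_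
    have hmem : θ i ∈ IntermediateField.adjoin ℚ (Set.range θ) :=
      IntermediateField.subset_adjoin ℚ _ (Set.mem_range_self i)
    have h1 : IsAlgebraic ℚ (⟨θ i, hmem⟩ : ↥(IntermediateField.adjoin ℚ (Set.range θ))) :=
      halg.isAlgebraic _
    exact IntermediateField.isAlgebraic_iff.mp h1
  · exact ApproximationPropertyDegOne.of_trdeg_eq_one θ
      (le_antisymm htr (Cardinal.one_le_iff_ne_zero.mpr h1))

end Summit.Schanuel.Schanuel.Theorems

end
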